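import Literature.NumberTheory.Rogawski1990.ArchEllipticOrbitHSBall      -- ★ p848531: `archPlane_inv_eq`, unitarity relations (same currency)
import HarnessLib

/-!
# Hyperbolic (split) orbits in `U(1,1)`: along the unipotent direction the Hilbert–Schmidt norm of `n γ n⁻¹` is an exact quadratic in the coordinate
# (`‖n_x γ n_x⁻¹‖²_HS = |λ₁|² + |λ₂|² + |x|² |λ₁ − λ₂|²`, `K`-conjugation invisible; orbit HS-balls are `K ×` an interval of length `≍ √R`)

Topic `NumberTheory/Rogawski1990`; namespace `Literature.NumberTheory.Rogawski1990`.  THEOREMS ONLY (no `def`, no instance, no notation, no axiom, no named fact,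
no `sorry`).  Cell `pub/hodgecm-mathlib`, crux H413 (`stmt-HodgeConjecture-24833`), F0∕P3c line LH3, DEAL #9 (VOL-split-id)+(VOL-split-stmt) of LH3-plan (g0)
(2026-09-02T03:20:38Z; seat LH3-p04 (g0)) — the split-class twin of ★ `ArchEllipticOrbitHSBall` (p848531), same plain-matrix currency (`Φ₂ = antidiag(1,1)` spelled
`Matrix.of fun i j : Fin 2 => if i.val + j.val + 1 = 2 then 1 else 0`, unitarity `ȳᵀ Φ₂ y = Φ₂`).

THE MATHEMATICS.  For `Φ₂ = antidiag(1,1)` the SPLIT torus of `U(Φ₂)(ℂ) ≅ U(1,1)` is the DIAGONAL one, `T_s = {diag(λ, λ̄⁻¹)}` (`diag_mem_unitary_antidiag_iff`: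
`diag(λ₁, λ₂)` is `Φ₂`-unitary iff `λ̄₁ λ₂ = 1`; regular split = `|λ| ≠ 1`), the compact torus is ★ `torusMatrix` (p848531), and the unipotent radical of the Borel
fixing `e₁` is `N = {n_x = (1 x; 0 1) : x ∈ iℝ}` (`unipotent_mem_unitary_antidiag_iff`: `n_x` is `Φ₂`-unitary iff `x + x̄ = 0`).  Since `T_s = M·A` centralises
`γ ∈ T_s` and `U(1,1) = K·N·A·M` (Iwasawa), the orbit of a split-regular `γ = diag(λ₁, λ₂)` is `{k n_x γ n_x⁻¹ k⁻¹ : k ∈ K, x ∈ iℝ}`, `K = U(Φ₂) ∩ U(2)`, and: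
* `n_x γ n_x⁻¹ = (λ₁ (λ₂−λ₁)x; 0 λ₂)` (`unipotent_conj_diagonal`), so **`Σ|(n_x γ n_x⁻¹)_{ij}|² = |λ₁|² + |λ₂|² + |x|²|λ₁ − λ₂|²`** (`hs_unipotent_conj_diagonal`);
* the Hilbert–Schmidt form is invariant under conjugation by unitary `k` (`hs_unitary_conj`, via `Σ|M_{ij}|² = Re tr(Mᴴ M)`, any size `n`);
* hence **`Σ|(k n_x γ n_x⁻¹ k⁻¹)_{ij}|² = |λ₁|² + |λ₂|² + |x|²|λ₁−λ₂|²`** (`hs_unitary_unipotent_conj_diagonal`) and the ORBIT HS-BALL IS `K ×` AN INTERVAL: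
  `Σ|(k n_x γ n_x⁻¹ k⁻¹)_{ij}|² ≤ R ⇒ |x| ≤ √R ∕ |λ₁ − λ₂|` (`norm_le_of_hs_orbit_le`) — length `≍ √R`, i.e. orbit volume `≲ R^{1∕2}` at the `Ξ`-exponent `e = 1∕2` of
  ★ `ArchSchwartzOrbitalIntegralConvergence` once the quotient measure `dν ∕ dt` on `U(1,1) ∕ T_s` is read in the `K·N` coordinates (`= dk·dx` up to the
  modular character of `A`, which is absent on the `γ`-orbit because `A ⊂ T_s`) — THAT measure half is (VOL-transport)'s session [BeuzartPlessis2020Asterisque,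
  §1.5 (1.5.2)–(1.5.3) p. 31]; this file lands the matrix identities and the set inclusion only.
HONEST LABEL: HC_CM is proved only modulo the 7 printed citations (2 remaining: hLiu418 = stmt-HodgeConjecture-24832, h413 = stmt-HodgeConjecture-24833) until rung 0
closes; this file closes no organ — it is one brick of (VOL) (residual of (CONV), A3-hardening of the LETTERS O1∕O3 of `stub_N9`).

## References
* [BeuzartPlessis2020Asterisque] R. Beuzart-Plessis, *A local trace formula for the Gan–Gross–Prasad conjecture for unitary groups: the archimedean case*,
  Astérisque 418 (2020), §1.5 (1.5.2)–(1.5.3) p. 31.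
* [Rogawski1990] J. D. Rogawski, *Automorphic Representations of Unitary Groups in Three Variables*, Ann. of Math. Stud. 123 (1990), §3.1 p. 19, §4.6 Prop. 4.6.1.
-/

set_option autoImplicit false

noncomputable section

open scoped Matrix ComplexConjugate

namespace Literature.NumberTheory.Rogawski1990

/-! ## §1 The split torus and the unipotent subgroup of `U(Φ₂)(ℂ)` -/

section Membership

/-- `diag(λ₁, λ₂)` is `Φ₂`-unitary iff `λ̄₁ λ₂ = 1` (and then `λ̄₂ λ₁ = 1`): the SPLIT torus of `U(antidiag(1,1))` is the diagonal one, `T_s = {diag(λ, λ̄⁻¹)}`.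
[cite: Rogawski1990, §3.1 p. 19] -/
theorem diag_mem_unitary_antidiag_iff (l₁ l₂ : ℂ) :
    ((!![l₁, 0; 0, l₂] : Matrix (Fin 2) (Fin 2) ℂ).map (starRingEnd ℂ))ᵀ * (Matrix.of fun i j : Fin 2 => if i.val + j.val + 1 = 2 then (1 : ℂ) else 0) * !![l₁, 0; 0, l₂] =
        (Matrix.of fun i j : Fin 2 => if i.val + j.val + 1 = 2 then (1 : ℂ) else 0) ↔
      conj l₁ * l₂ = 1 := by
  constructor
  · intro h
    have h01 := congrFun (congrFun h 0) 1
    simpa [Matrix.mul_apply, Fin.sum_univ_two] using h01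
  · intro h
    have h' : conj l₂ * l₁ = 1 := by
      have := congrArg conj h
      simpa [map_mul, mul_comm] using this
    ext i j
    fin_cases i <;> fin_cases j <;> simp [Matrix.mul_apply, Fin.sum_univ_two, h, h']

/-- `n_x = (1 x; 0 1)` is `Φ₂`-unitary iff `x + x̄ = 0` (`x ∈ iℝ`): the unipotent radical `N` of the Borel of `U(1,1)` fixing the isotropic line `ℂ e₁`.
[cite: Rogawski1990, §3.1 p. 19] -/
theorem unipotent_mem_unitary_antidiag_iff (x : ℂ) :
    ((!![1, x; 0, 1] : Matrix (Fin 2) (Fin 2) ℂ).map (starRingEnd ℂ))ᵀ * (Matrix.of fun i j : Fin 2 => if i.val + j.val + 1 = 2 then (1 : ℂ) else 0) * !![1, x; 0, 1] =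
        (Matrix.of fun i j : Fin 2 => if i.val + j.val + 1 = 2 then (1 : ℂ) else 0) ↔
      x + conj x = 0 := by
  constructor
  · intro h
    have h11 := congrFun (congrFun h 1) 1
    simp [Matrix.mul_apply, Fin.sum_univ_two] at h11
    linear_combination h11
  · intro h
    ext i j
    fin_cases i <;> fin_cases j <;> simp [Matrix.mul_apply, Fin.sum_univ_two]
    linear_combination h

end Membership

/-! ## §2 Conjugation of a diagonal element by a unipotent: the exact Hilbert–Schmidt norm -/

section Unipotent

/-- `(1 x; 0 1)⁻¹ = (1 −x; 0 1)`. [folklore] -/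
private theorem unipotent_inv (x : ℂ) : ((!![1, x; 0, 1] : Matrix (Fin 2) (Fin 2) ℂ))⁻¹ = !![1, -x; 0, 1] := by
  apply Matrix.inv_eq_left_inv
  ext i j
  fin_cases i <;> fin_cases j <;> simp [Matrix.mul_apply, Fin.sum_univ_two]

/-- **`n_x · diag(λ₁, λ₂) · n_x⁻¹ = (λ₁ (λ₂ − λ₁)x; 0 λ₂)`.** [cite: Rogawski1990, §3.1 p. 19] -/
theorem unipotent_conj_diagonal (x l₁ l₂ : ℂ) :
    (!![1, x; 0, 1] : Matrix (Fin 2) (Fin 2) ℂ) * !![l₁, 0; 0, l₂] * (!![1, x; 0, 1] : Matrix (Fin 2) (Fin 2) ℂ)⁻¹ = !![l₁, (l₂ - l₁) * x; 0, l₂] := by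
  rw [unipotent_inv]
  ext i j
  fin_cases i <;> fin_cases j <;> simp [Matrix.mul_apply, Fin.sum_univ_two]
  ring

/-- **THE SPLIT-ORBIT IDENTITY along `N`**: `Σ_{ij} |(n_x diag(λ₁, λ₂) n_x⁻¹)_{ij}|² = |λ₁|² + |λ₂|² + |x|² |λ₁ − λ₂|²`.
[cite: BeuzartPlessis2020Asterisque, §1.5 p. 31] [cite: Rogawski1990, §3.1 p. 19] -/
theorem hs_unipotent_conj_diagonal (x l₁ l₂ : ℂ) :
    ∑ i : Fin 2, ∑ j : Fin 2, ‖((!![1, x; 0, 1] : Matrix (Fin 2) (Fin 2) ℂ) * !![l₁, 0; 0, l₂] * (!![1, x; 0, 1] : Matrix (Fin 2) (Fin 2) ℂ)⁻¹) i j‖ ^ 2 =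
      ‖l₁‖ ^ 2 + ‖l₂‖ ^ 2 + ‖x‖ ^ 2 * ‖l₁ - l₂‖ ^ 2 := by
  rw [unipotent_conj_diagonal]
  simp only [Fin.sum_univ_two, Matrix.of_apply, Matrix.cons_val', Matrix.cons_val_zero, Matrix.cons_val_one, Matrix.empty_val',
    Matrix.cons_val_fin_one, norm_zero, norm_mul]
  rw [show ‖l₂ - l₁‖ = ‖l₁ - l₂‖ from norm_sub_rev l₂ l₁]
  ring

end Unipotent

/-! ## §3 Unitary conjugation is invisible to the Hilbert–Schmidt form (any size) -/

section Unitary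

variable {n : Type*} [Fintype n] [DecidableEq n]

omit [DecidableEq n] in
/-- `Σ_{ij} |M_{ij}|² = Re tr(Mᴴ M)`. [folklore] -/
private theorem hs_eq_re_trace_conjTranspose_mul (M : Matrix n n ℂ) :
    ∑ i, ∑ j, ‖M i j‖ ^ 2 = (Matrix.trace (Mᴴ * M)).re := by
  rw [Matrix.trace, Complex.re_sum, Finset.sum_comm]
  refine Finset.sum_congr rfl fun j _ => ?_
  rw [Matrix.diag_apply, Matrix.mul_apply, Complex.re_sum]
  refine Finset.sum_congr rfl fun i _ => ?_
  have h : (Mᴴ j i) * M i j = ((Complex.normSq (M i j) : ℝ) : ℂ) := by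
    rw [Matrix.conjTranspose_apply, Complex.normSq_eq_conj_mul_self]
    rfl
  rw [h, Complex.ofReal_re, Complex.sq_norm]

/-- **HS is invariant under unitary conjugation**: for `kᴴ k = 1`, `Σ|(k M k⁻¹)_{ij}|² = Σ|M_{ij}|²` (`k⁻¹ = kᴴ`, `tr((kMkᴴ)ᴴ kMkᴴ) = tr(kᴴk Mᴴ M)`).
[folklore] [cite: BeuzartPlessis2020Asterisque, §1.5 p. 31] -/
theorem hs_unitary_conj {k : Matrix n n ℂ} (hk : kᴴ * k = 1) (M : Matrix n n ℂ) :
    ∑ i, ∑ j, ‖(k * M * k⁻¹) i j‖ ^ 2 = ∑ i, ∑ j, ‖M i j‖ ^ 2 := by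
  have hinv : k⁻¹ = kᴴ := Matrix.inv_eq_left_inv hk
  rw [hs_eq_re_trace_conjTranspose_mul, hs_eq_re_trace_conjTranspose_mul, hinv]
  congr 1
  have e : (k * M * kᴴ)ᴴ * (k * M * kᴴ) = k * (Mᴴ * M * kᴴ) := by
    rw [Matrix.conjTranspose_mul, Matrix.conjTranspose_mul, Matrix.conjTranspose_conjTranspose]
    simp only [Matrix.mul_assoc]
    rw [← Matrix.mul_assoc kᴴ k, hk, Matrix.one_mul]
  rw [e, Matrix.trace_mul_comm, Matrix.mul_assoc, hk, Matrix.mul_one]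

end Unitary

/-! ## §4 The split orbit through `K · N`: HS-balls are `K ×` an interval of length `≍ √R` -/

section SplitOrbit

/-- **`Σ|(k n_x diag(λ₁,λ₂) n_x⁻¹ k⁻¹)_{ij}|² = |λ₁|² + |λ₂|² + |x|²|λ₁ − λ₂|²`** for unitary `k` (`kᴴ k = 1`; in the application `k ∈ K = U(Φ₂) ∩ U(2)`) and any `x`
(in the application `x ∈ iℝ`): the `K`-coordinate is invisible, the `N`-coordinate enters quadratically. [cite: BeuzartPlessis2020Asterisque, §1.5 (1.5.2)–(1.5.3) p. 31] -/
theorem hs_unitary_unipotent_conj_diagonal {k : Matrix (Fin 2) (Fin 2) ℂ} (hk : kᴴ * k = 1) (x l₁ l₂ : ℂ) :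
    ∑ i : Fin 2, ∑ j : Fin 2,
        ‖(k * ((!![1, x; 0, 1] : Matrix (Fin 2) (Fin 2) ℂ) * !![l₁, 0; 0, l₂] * (!![1, x; 0, 1] : Matrix (Fin 2) (Fin 2) ℂ)⁻¹) * k⁻¹) i j‖ ^ 2 =
      ‖l₁‖ ^ 2 + ‖l₂‖ ^ 2 + ‖x‖ ^ 2 * ‖l₁ - l₂‖ ^ 2 := by
  rw [hs_unitary_conj hk, hs_unipotent_conj_diagonal]

/-- **ORBIT HS-BALL ⊆ `K ×` INTERVAL**: if `Σ|(k n_x diag(λ₁,λ₂) n_x⁻¹ k⁻¹)_{ij}|² ≤ R` with `k` unitary and `λ₁ ≠ λ₂` (split-regular), then `|x| ≤ √R ∕ |λ₁ − λ₂|`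
(indeed `|x|² |λ₁−λ₂|² ≤ R − |λ₁|² − |λ₂|²`). [cite: BeuzartPlessis2020Asterisque, §1.5 (1.5.2)–(1.5.3) p. 31] -/
theorem norm_le_of_hs_orbit_le {k : Matrix (Fin 2) (Fin 2) ℂ} (hk : kᴴ * k = 1) {x l₁ l₂ : ℂ} (hne : l₁ ≠ l₂) {R : ℝ}
    (hR : ∑ i : Fin 2, ∑ j : Fin 2,
        ‖(k * ((!![1, x; 0, 1] : Matrix (Fin 2) (Fin 2) ℂ) * !![l₁, 0; 0, l₂] * (!![1, x; 0, 1] : Matrix (Fin 2) (Fin 2) ℂ)⁻¹) * k⁻¹) i j‖ ^ 2 ≤ R) :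
    ‖x‖ ≤ Real.sqrt R / ‖l₁ - l₂‖ := by
  rw [hs_unitary_unipotent_conj_diagonal hk] at hR
  have hl : 0 < ‖l₁ - l₂‖ := norm_pos_iff.mpr (sub_ne_zero.mpr hne)
  have hsq : (‖x‖ * ‖l₁ - l₂‖) ^ 2 ≤ R := by
    rw [mul_pow]; nlinarith [sq_nonneg ‖l₁‖, sq_nonneg ‖l₂‖]
  have hle : ‖x‖ * ‖l₁ - l₂‖ ≤ Real.sqrt R :=
    (Real.le_sqrt (mul_nonneg (norm_nonneg _) hl.le) (le_trans (by positivity) hsq)).mpr hsq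
  rw [le_div_iff₀ hl]
  exact hle

/-- The sharper radius: `|x|² |λ₁ − λ₂|² ≤ R − |λ₁|² − |λ₂|²` (so the ball is EMPTY for `R < |λ₁|² + |λ₂|²`). [cite: BeuzartPlessis2020Asterisque, §1.5 (1.5.2)–(1.5.3) p. 31] -/
theorem normSq_mul_le_of_hs_orbit_le {k : Matrix (Fin 2) (Fin 2) ℂ} (hk : kᴴ * k = 1) {x l₁ l₂ : ℂ} {R : ℝ}
    (hR : ∑ i : Fin 2, ∑ j : Fin 2,
        ‖(k * ((!![1, x; 0, 1] : Matrix (Fin 2) (Fin 2) ℂ) * !![l₁, 0; 0, l₂] * (!![1, x; 0, 1] : Matrix (Fin 2) (Fin 2) ℂ)⁻¹) * k⁻¹) i j‖ ^ 2 ≤ R) :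
    ‖x‖ ^ 2 * ‖l₁ - l₂‖ ^ 2 ≤ R - ‖l₁‖ ^ 2 - ‖l₂‖ ^ 2 := by
  rw [hs_unitary_unipotent_conj_diagonal hk] at hR
  linarith

end SplitOrbit

end Literature.NumberTheory.Rogawski1990

end
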